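import Literature.MathematicalPhysics.QuantumFieldTheory.Balaban1983to89.B2Prop31MinimizerRegionsN

/-!
# `Balaban1983to89.B2Eq245Theta` — [Balaban1982Higgs2] p. 567 (the cut-offs `θ_k` entering (2.45), (2.51), (3.2)): **the functions `θ_k`
CONSTRUCTED from the (2.7)–(2.8) regions on the concrete (Higgs)₂,₃ tori** — *"The function θ_k is defined on T_η, is equal to 1 on
B^{k−1}(Λ₂^{(k−1)}) and varies "smoothly" from 1 to 0 on a slice of thickness < M surrounding B^{k−1}(Λ₂^{(k−1)})"* — as the clamp of the fine
torus distance to `B^{k−1}(Λ₂^{(k−1)})` with ramp length `M·L^{k−1}` (fine units), and ALL the `θ`-hypotheses of the Prop.-3.1 carriers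
(`Nested`, range, `θ_one`, `θ_zero`, `θ_above`, `θ_lip`, and the slice inclusion `slice_sub` over `(Λ₁^{(k−1)})′`) PROVED for it; hence a
constructor `RegionsDataN.ofFields` (`n ≤ 2`) of p23 g13's constructed-regions family whose ONLY data are print's free data: the torus, the
large-field points of every step, the charge, `A₀`, the block fields `A_k`, the configuration `Φ`

statement-level skeleton of published theorems with citation tags; proofs where landed; nothing here is a claim about the Yang–Mills mass gap

CITATION HEADER.  T. Bałaban, *(Higgs)₂,₃ quantum fields in a finite volume. II. An upper bound*, Commun. Math. Phys. **86** (1982) 555–594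
[Balaban1982Higgs2] (PDF held `paper:balaban1982-cmp86-higgs23-ii`, journal page = PDF page + 554; pp. 558, 566–567 [PDF 12–13], 569 (2.51), 576,
583, 588 on the ×2 renders `run/shared/lean/pub/pub-balaban/b2b-balaban-ref1/pages/1982-cmp86-higgs23-II/…`); part I [Balaban1982Higgs1] (1.3) p. 604,
(1.20) p. 607; the distance weight is r14's `B1Cor23ZeroFieldRegion.exists_weight` ([Balaban1983RegularityDecay] Cor. 2.3 device).  Cell `lit-balaban`,
Phase-2 proof seat **p23** gen 13 (unit `lit-balaban-p23-g13`; successor of p320781 — GAPS.md G-B2-12 addendum, owner ruling r02 2026-08-22T06:30Z: repair (c₂), `n = 2`).  SKELETON rows **B2.Eq2.44** ((2.44)–(2.52)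
densities, where `θ_k` is introduced; owner r02), **B2.Prop3.1**, **B2.Eq3.1-3.10** ((3.2)) — CELLS ONLY, no head claims.  USED BY NAME, NOTHING
RESTATED: p23 g13 `B2Prop31MinimizerRegionsN.{RegionsDataN, dataTowerN, L2OfN, radN, R_pos_ofN, towerRad…}` (p320781), `B2Prop31MinimizerRegions.
{towerRad, towerRad_eq, le_towerRad, towerRad_nonneg, L1Of}` (p319405), `B2Eq28RegionsCollars.{mem_regionRel_of_tdist_le, prime_mono}` (p318957),
r14's `B1Cor23ZeroFieldRegion.exists_weight`, `B2Lemma23HiggsLattice.tdist_blockIter_shift_le_one`, `B1Ineq234Concrete.tdist_blockIter_le_real`, the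
typer's `B2Eq243RegionsTower.{towerRegion, towerRegion_eq, towerOf_lam_of_lt, towerRegion_antitone, towerRegion_blockOf_congr,
mem_seven_of_blockOf_mem_succ}`, p15's `prime`/`mem_prime`/`Tower.lamAt`, `B2Sect2BDensities.Nested`, `PlateauMollifier.abs_clamp_sub_clamp_le`.

WHAT IS PRINTED.  p. 566–567 (quoted above); (2.51) p. 569 (the telescoping needs `θ_{j+1}θ_j = θ_{j+1}` = r14's `Nested`); (3.2) p. 583
`Ã^ε = Σ_k (1 − θ_{k+1})θ_kA^{(k),ε} + …`; (2.8) p. 558 (the regions are `r(L^{k−1}ε)`-collared, `r ≫ M`); p. 566 *"In general Λ₀^{(j+1)} ⊂ Λ₇^{(j)′}"*.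

DICTIONARY (index `i = k − 1`, so no truncated subtraction enters the kernel statements).  `Bⁱ(Λ₂^{(i)})` ↦ `plateau i = under i (towerRegion bad r i 2)`
(fine sites whose `i`-block label lies in `Λ₂^{(i)}`); `dist(z, Bⁱ(Λ₂^{(i)}))` (fine lattice units, (I.1.3)) ↦ `distTo` (r14's weight: `0` on the set,
`≥ 0`, 1-Lipschitz, `≥ w` when every point of the set is `≥ w` away); *"slice of thickness < M"* (`T₁^{(i)}`-units = `M·Lⁱ` fine units) ↦ the ramp
`width P i = M·Lⁱ`; `θ_{i+1}(z) = max(0, min(1, 1 − dist/width))` when `i + 1 ≤ K` and `Bⁱ(Λ₂^{(i)}) ≠ ∅`, `θ₀ = 0`, `θ_k = 0` for `k > K` (print's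
cut-offs are `θ_1, …, θ_K`; (3.2) p.583).

WHAT THIS MODULE PROVES (kernel-checked, 0 `sorry`, standard axioms; definitions with bodies `under`, `distTo`, `width`, `plateau`, `thetaOf`,
`RegionsDataN.ofFields`; no `Prop` facts).
 §1 `under`/`mem_under`; `distTo` + `distTo_lip`/`distTo_eq_zero`/`distTo_nonneg`/`exists_near_of_distTo_lt`; `width`/`width_pos`.
 §2 `plateau`/`mem_plateau`; `thetaOf` + `thetaOf_zero_level`/`thetaOf_succ`/`thetaOf_succ_of_not`/`thetaOf_succ_of`, `thetaOf_range`,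
    **`thetaOf_eq_one_of_mem`** (*"equal to 1 on B^{k−1}(Λ₂^{(k−1)})"*), **`exists_near_of_thetaOf_ne_zero`** (support within fine distance `< M·L^{k−1}`
    of it: *"slice of thickness < M"*), **`thetaOf_lip`** (`|θ_{k+1}(z+εe_ν) − θ_{k+1}(z)| ≤ M⁻¹L^{−k}`: *"varies smoothly"*), `thetaOf_above`.
 §3 consequences of the (2.8) collars (`M + 1 ≤ r(Lʲε)`): `blockIter_mem_one_of_thetaOf_ne_zero` (θ_{i+1} ≠ 0 at `y`, `|z_i − y_i| ≤ 1` ⇒ `z_i ∈ Λ₁^{(i)}`),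
    `blockIter_mem_two_of_succ` (`z_{i+1} ∈ Λ₁^{(i+1)}` ⇒ `z_i ∈ Λ₂^{(i)}`, p.566), **`nested_thetaOf`** (r14's `Nested`: via `Λ₁^{(j)} ⊂ Λ₇^{(j−1)′} ⊂
    (Λ₂^{(j−1)})′`), **`thetaOf_one`** (= 1 on `B^{k−1}(Λ₅^{(k−1)})` and its neighbours: `Λ₅ → Λ₄` one collar), **`thetaOf_zero`** (supp θ_{k+2} and
    neighbours over `Bᵏ(Λ₅^{(k)})`: `Λ₁^{(k+1)} ⊂ Λ₇^{(k)′}`), **`thetaOf_slice`** (the slice labels lie in `(Λ₁^{(k−1)})′` — print's slice surrounds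
    `B^{k−1}(Λ₂^{(k−1)})` from outside; GAPS.md G-B2-12 addendum, owner ruling r02 06:30Z: repair (c₂), `n = 2`).
 §4 `M_add_one_le_towerRad`; **`RegionsDataN.ofFields`** (`1 ≤ n ≤ 2`, `R ≥ (L/n)(2M + 8)`, `r ≥ 1`, `Lᴷε ≤ ε₀`, `Lᴷε ≤ 1`, `c_θ·M ≥ 1`): the datum of
    p320781's family with `θ := thetaOf` and EVERY `θ`-field and `slice_sub` DISCHARGED; `ofFields_θ` (rfl).
HONEST SCOPE.  (i) The profile is piecewise-linear in the fine distance (print: "smoothly" in quotes = the difference bound `|∂θ| ≤ O(1)`, here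
`O(1) = 1/M ≤ c_θ`); the slice `{0 < θ_k < 1}` has thickness `< M` large-block units as printed.  (ii) `θ_k := 0` when `B^{k−1}(Λ₂^{(k−1)}) = ∅` (print's
recipe then constrains nothing; every proved property holds).  (iii) Levels `k ≤ K ≤` the lattice's.  (iv) Needs `n ≤ 2` (the slice labels are in
`(Λ₁)′`, not in `(Λ₂)′`: p319405's `n = 3` family cannot host this `θ`; `n = 2` is the owner's repair (c₂)).  (v) Multi-step non-vacuity of the
(2.55)-type restrictions (`restrictedM` for `K ≥ 2`) is not addressed here (K = 1: p320781 `regionsDataWN_field_ne_zero`).  No row head changes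
(owner r02).  Nothing here is summit progress.
-/

noncomputable section

open Finset Real
open scoped BigOperators

namespace Literature.MathematicalPhysics.QuantumFieldTheory.Balaban1983to89.B2Eq245Theta

open Literature.MathematicalPhysics.QuantumFieldTheory.Balaban1983to89.HiggsLattice
open Literature.MathematicalPhysics.QuantumFieldTheory.Balaban1983to89.HiggsAveraging
open Literature.MathematicalPhysics.QuantumFieldTheory.Balaban1983to89.B2Eq337ScalarIntegration
open Literature.MathematicalPhysics.QuantumFieldTheory.Balaban1983to89.B2Eq328ConcretePieces
open Literature.MathematicalPhysics.QuantumFieldTheory.Balaban1983to89.B2Eq324NestedRegions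
open Literature.MathematicalPhysics.QuantumFieldTheory.Balaban1983to89.B2Prop31MinimizerFamily (MinConsts)
open Literature.MathematicalPhysics.QuantumFieldTheory.Balaban1983to89.B1Eq211ZeroFieldTorus (Shape)
open Literature.MathematicalPhysics.QuantumFieldTheory.Balaban1983to89.B2Eq243RegionsTower
  (towerRegion towerRegion_eq towerOf towerOf_lam_of_lt towerRegion_antitone towerRegion_blockOf_congr mem_seven_of_blockOf_mem_succ)
open Literature.MathematicalPhysics.QuantumFieldTheory.Balaban1983to89.B2Eq255RegionsWindow (regionRel)
open Literature.MathematicalPhysics.QuantumFieldTheory.Balaban1983to89.B2Eq28RegionsCollars (mem_regionRel_of_tdist_le prime_mono)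
open Literature.MathematicalPhysics.QuantumFieldTheory.Balaban1983to89.B2Prop31MinimizerRegions
  (towerRad towerRad_eq le_towerRad towerRad_nonneg L1Of)
open Literature.MathematicalPhysics.QuantumFieldTheory.Balaban1983to89.B2Prop31MinimizerRegionsN
  (RegionsDataN dataTowerN L2OfN R_pos_ofN)
open Literature.MathematicalPhysics.QuantumFieldTheory.Balaban1983to89.B1Cor23ZeroFieldRegion (exists_weight)
open Literature.MathematicalPhysics.QuantumFieldTheory.Balaban1983to89.B2Lemma23HiggsLattice (tdist_blockIter_shift_le_one)
open Literature.MathematicalPhysics.QuantumFieldTheory.Balaban1983to89.B1Ineq234Concrete (tdist_blockIter_le_real)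
open Literature.MathematicalPhysics.QuantumFieldTheory.Balaban1983to89.B1Ineq234LevelZero (tdist_comm tdist_triangle_real tdist_shift_le_one)
open B2Sect2BDensities (Nested)

variable {P : HiggsLattice.Params}

/-! ## §1 The fine set under a region, the distance weight, the ramp width -/

/-- `B^j(Λ)`: the fine sites whose `j`-block label lies in `Λ ⊂ T^{(j)}` ((I.1.18)/(I.1.20)). [cite: Balaban1982Higgs1, (1.20) p.607] -/
def under (j : ℕ) (Λ : Finset (HiggsLattice.Site P j)) : Finset (HiggsLattice.Site P 0) :=
  univ.filter fun z => blockIter j z ∈ Λ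

/-- Membership in `B^j(Λ)`. [cite: Balaban1982Higgs1, (1.20) p.607] -/
theorem mem_under {j : ℕ} {Λ : Finset (HiggsLattice.Site P j)} {z : HiggsLattice.Site P 0} : z ∈ under j Λ ↔ blockIter j z ∈ Λ := by
  simp [under]

/-- **The fine torus distance to a set of sites** (lattice units of `T_ε`): r14's 1-Lipschitz weight `dist(·, T)` for `T ≠ ∅`, and `0` for
`T = ∅`. [cite: Balaban1982Higgs1, (1.3) p.604] -/
def distTo (T : Finset (HiggsLattice.Site P 0)) : HiggsLattice.Site P 0 → ℝ :=
  if h : T.Nonempty then Classical.choose (exists_weight h) else fun _ => 0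

/-- `dist(·, T)` is 1-Lipschitz for (I.1.3). [cite: Balaban1982Higgs1, (1.3) p.604] -/
theorem distTo_lip (T : Finset (HiggsLattice.Site P 0)) (x z : HiggsLattice.Site P 0) :
    |distTo T x - distTo T z| ≤ (HiggsLattice.Site.tdist x z : ℝ) := by
  unfold distTo
  split_ifs with h
  · exact (Classical.choose_spec (exists_weight h)).1 x z
  · simp

/-- `dist(x, T) = 0` for `x ∈ T`. [cite: Balaban1982Higgs1, (1.3) p.604] -/
theorem distTo_eq_zero {T : Finset (HiggsLattice.Site P 0)} {x : HiggsLattice.Site P 0} (hx : x ∈ T) : distTo T x = 0 := by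
  unfold distTo
  rw [dif_pos ⟨x, hx⟩]
  exact (Classical.choose_spec (exists_weight ⟨x, hx⟩)).2.1 x hx

/-- `dist(x, T) ≥ 0`. [cite: Balaban1982Higgs1, (1.3) p.604] -/
theorem distTo_nonneg (T : Finset (HiggsLattice.Site P 0)) (x : HiggsLattice.Site P 0) : 0 ≤ distTo T x := by
  unfold distTo
  split_ifs with h
  · exact (Classical.choose_spec (exists_weight h)).2.2.1 x
  · simp

/-- If `dist(x, T) < w` (and `T ≠ ∅`) some point of `T` is within `< w` of `x`. [cite: Balaban1982Higgs1, (1.3) p.604] -/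
theorem exists_near_of_distTo_lt {T : Finset (HiggsLattice.Site P 0)} (hT : T.Nonempty) {x : HiggsLattice.Site P 0} {w : ℝ}
    (h : distTo T x < w) : ∃ t ∈ T, (HiggsLattice.Site.tdist x t : ℝ) < w := by
  by_contra hne
  push Not at hne
  have h4 := (Classical.choose_spec (exists_weight hT)).2.2.2 x w hne
  unfold distTo at h
  rw [dif_pos hT] at h
  linarith

/-- **The ramp width of `θ_{i+1}`**: `M·Lⁱ` fine units = the printed *"slice of thickness < M"* in units of `T₁^{(i)}`. [cite: Balaban1982Higgs2, p.567] -/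
def width (P : HiggsLattice.Params) (i : ℕ) : ℝ := (P.M : ℝ) * (P.L : ℝ) ^ i

/-- `width > 0`. [cite: Balaban1982Higgs2, p.567] -/
theorem width_pos (P : HiggsLattice.Params) (i : ℕ) : 0 < width P i := by
  unfold width
  have hM : (0 : ℝ) < (P.M : ℝ) := by exact_mod_cast P.hM
  have hL : (0 : ℝ) < (P.L : ℝ) := by exact_mod_cast P.hL
  positivity

/-! ## §2 The cut-offs `θ_k` and their pointwise properties -/

section Theta

variable (Q : B2.Params) (P : HiggsLattice.Params) (bad : (j : ℕ) → Set (HiggsLattice.Site P j)) (K : ℕ)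

/-- **The set `Bⁱ(Λ₂^{(i)})` on which `θ_{i+1} = 1`** (regions of the constructed tower, radius `r(Lⁱε)`). [cite: Balaban1982Higgs2, p.567] -/
def plateau (i : ℕ) : Finset (HiggsLattice.Site P 0) := under i (towerRegion bad (towerRad Q P) i 2)

/-- **THE CUT-OFFS `θ_k` OF p. 567 FOR THE CONSTRUCTED REGIONS**: `θ₀ = 0`; for `k = i + 1 ≤ K` (and `Bⁱ(Λ₂^{(i)}) ≠ ∅`)
`θ_{i+1}(z) = max(0, min(1, 1 − dist(z, Bⁱ(Λ₂^{(i)}))/(M·Lⁱ)))`; `0` above `K`. [cite: Balaban1982Higgs2, p.567, (2.45) p.567, (3.2) p.583] -/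
def thetaOf : ℕ → HiggsLattice.Site P 0 → ℝ
  | 0, _ => 0
  | i + 1, z =>
    if i + 1 ≤ K ∧ (plateau Q P bad i).Nonempty then max 0 (min 1 (1 - distTo (plateau Q P bad i) z / width P i)) else 0

variable {Q P bad K}

/-- Membership in the plateau set. [cite: Balaban1982Higgs2, p.567] -/
theorem mem_plateau {i : ℕ} {z : HiggsLattice.Site P 0} : z ∈ plateau Q P bad i ↔ blockIter i z ∈ towerRegion bad (towerRad Q P) i 2 :=
  mem_under

/-- `θ₀ = 0` (no cut-off at level `0`; print's `θ_k` start at `k = 1`). [cite: Balaban1982Higgs2, (2.45) p.567] -/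
theorem thetaOf_zero_level (z : HiggsLattice.Site P 0) : thetaOf Q P bad K 0 z = 0 := rfl

/-- The defining equation at a successor level. [cite: Balaban1982Higgs2, p.567] -/
theorem thetaOf_succ (i : ℕ) (z : HiggsLattice.Site P 0) : thetaOf Q P bad K (i + 1) z =
    if i + 1 ≤ K ∧ (plateau Q P bad i).Nonempty then max 0 (min 1 (1 - distTo (plateau Q P bad i) z / width P i)) else 0 := rfl

/-- Off the admissible levels (or with an empty plateau) `θ_{i+1} = 0`. [cite: Balaban1982Higgs2, p.567] -/
theorem thetaOf_succ_of_not {i : ℕ} (h : ¬ (i + 1 ≤ K ∧ (plateau Q P bad i).Nonempty)) (z : HiggsLattice.Site P 0) :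
    thetaOf Q P bad K (i + 1) z = 0 := by
  rw [thetaOf_succ, if_neg h]

/-- On an admissible level with a nonempty plateau, `θ_{i+1}` is the clamp profile. [cite: Balaban1982Higgs2, p.567] -/
theorem thetaOf_succ_of {i : ℕ} (h : i + 1 ≤ K ∧ (plateau Q P bad i).Nonempty) (z : HiggsLattice.Site P 0) :
    thetaOf Q P bad K (i + 1) z = max 0 (min 1 (1 - distTo (plateau Q P bad i) z / width P i)) := by
  rw [thetaOf_succ, if_pos h]

/-- `0 ≤ θ_k ≤ 1`. [cite: Balaban1982Higgs2, p.567] -/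
theorem thetaOf_range (k : ℕ) (z : HiggsLattice.Site P 0) : 0 ≤ thetaOf Q P bad K k z ∧ thetaOf Q P bad K k z ≤ 1 := by
  cases k with
  | zero => rw [thetaOf_zero_level]; norm_num
  | succ i =>
    by_cases h : i + 1 ≤ K ∧ (plateau Q P bad i).Nonempty
    · rw [thetaOf_succ_of h]
      exact ⟨le_max_left _ _, max_le zero_le_one (min_le_left _ _)⟩
    · rw [thetaOf_succ_of_not h]; norm_num

/-- **"equal to 1 on B^{k−1}(Λ₂^{(k−1)})"**: `θ_{i+1}(z) = 1` for `z_i ∈ Λ₂^{(i)}`, `i + 1 ≤ K`. [cite: Balaban1982Higgs2, p.567] -/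
theorem thetaOf_eq_one_of_mem {i : ℕ} (hi : i + 1 ≤ K) {z : HiggsLattice.Site P 0} (hz : z ∈ plateau Q P bad i) :
    thetaOf Q P bad K (i + 1) z = 1 := by
  rw [thetaOf_succ_of ⟨hi, ⟨z, hz⟩⟩, distTo_eq_zero hz, zero_div, sub_zero, min_self, max_eq_right zero_le_one]

/-- **"a slice of thickness < M surrounding B^{k−1}(Λ₂^{(k−1)})"**: if `θ_{i+1}(z) ≠ 0` then `i + 1 ≤ K` and some point of `Bⁱ(Λ₂^{(i)})` lies within
fine distance `< M·Lⁱ` of `z`. [cite: Balaban1982Higgs2, p.567] -/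
theorem exists_near_of_thetaOf_ne_zero {i : ℕ} {z : HiggsLattice.Site P 0} (h : thetaOf Q P bad K (i + 1) z ≠ 0) :
    i + 1 ≤ K ∧ ∃ t ∈ plateau Q P bad i, (HiggsLattice.Site.tdist z t : ℝ) < width P i := by
  by_cases hc : i + 1 ≤ K ∧ (plateau Q P bad i).Nonempty
  · refine ⟨hc.1, exists_near_of_distTo_lt hc.2 ?_⟩
    by_contra hge
    rw [not_lt] at hge
    apply h
    rw [thetaOf_succ_of hc]
    have : 1 - distTo (plateau Q P bad i) z / width P i ≤ 0 := by
      rw [sub_nonpos, le_div_iff₀ (width_pos P i), one_mul]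
      exact hge
    exact max_eq_left (min_le_of_right_le this)
  · exact absurd (thetaOf_succ_of_not hc z) h

/-- **"varies smoothly"**: `|θ_{k+1}(z + εe_ν) − θ_{k+1}(z)| ≤ M⁻¹·L^{−k}` (the clamp is 1-Lipschitz, `dist` moves by `≤ 1` per fine step, ramp `M·Lᵏ`).
[cite: Balaban1982Higgs2, p.567] -/
theorem thetaOf_lip (k : ℕ) (z : HiggsLattice.Site P 0) (ν : Fin P.d) :
    |thetaOf Q P bad K (k + 1) (z.shift ν) - thetaOf Q P bad K (k + 1) z| ≤ (P.M : ℝ)⁻¹ * ((P.L : ℝ) ^ k)⁻¹ := by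
  have hM : (0 : ℝ) < (P.M : ℝ) := by exact_mod_cast P.hM
  have hL : (0 : ℝ) < (P.L : ℝ) ^ k := pow_pos (by exact_mod_cast P.hL) k
  by_cases hc : k + 1 ≤ K ∧ (plateau Q P bad k).Nonempty
  · rw [thetaOf_succ_of hc, thetaOf_succ_of hc]
    refine (Literature.NumberTheory.LFunctions.PlateauMollifier.abs_clamp_sub_clamp_le _ _).trans ?_
    have h1 : 1 - distTo (plateau Q P bad k) (z.shift ν) / width P k - (1 - distTo (plateau Q P bad k) z / width P k)
        = -((distTo (plateau Q P bad k) (z.shift ν) - distTo (plateau Q P bad k) z) / width P k) := by ring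
    rw [h1, abs_neg, abs_div, abs_of_pos (width_pos P k), div_le_iff₀ (width_pos P k)]
    have h2 := distTo_lip (plateau Q P bad k) (z.shift ν) z
    have h3 : (HiggsLattice.Site.tdist (z.shift ν) z : ℝ) ≤ 1 := by
      rw [tdist_comm]; exact_mod_cast tdist_shift_le_one z ν
    have h4 : (P.M : ℝ)⁻¹ * ((P.L : ℝ) ^ k)⁻¹ * width P k = 1 := by unfold width; field_simp
    rw [h4]
    linarith
  · rw [thetaOf_succ_of_not hc, thetaOf_succ_of_not hc, sub_self, abs_zero]
    positivity

/-- `θ_m = 0` above `K`. [cite: Balaban1982Higgs2, (3.2) p.583] -/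
theorem thetaOf_above {m : ℕ} (hm : K < m) (z : HiggsLattice.Site P 0) : thetaOf Q P bad K m z = 0 := by
  cases m with
  | zero => rfl
  | succ i => exact thetaOf_succ_of_not (fun h => absurd h.1 (by omega)) z

end Theta

/-! ## §3 Consequences of the (2.8) collars: nesting, `θ_one`, `θ_zero`, the slice inclusion -/

section Collars

variable {Q : B2.Params} {bad : (j : ℕ) → Set (HiggsLattice.Site P j)} {K : ℕ}

/-- **The support of `θ_{i+1}` and its one-step neighbourhood lie over `Λ₁^{(i)}`** (`M + 1 ≤ r(Lⁱε)`, `K ≤` the lattice's): if `θ_{i+1}(y) ≠ 0`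
and `|z_i − y_i| ≤ 1` then `z_i ∈ Λ₁^{(i)}` — `y` is within `< M·Lⁱ` of `Bⁱ(Λ₂^{(i)})`, so `y_i` is within `M` and `z_i` within `M + 1 ≤ r` of
`Λ₂^{(i)}`: one (2.8)-collar. [cite: Balaban1982Higgs2, p.567, (2.8) p.558] -/
theorem blockIter_mem_one_of_thetaOf_ne_zero (hK : K ≤ P.K) (hM : ∀ j, (P.M : ℝ) + 1 ≤ towerRad Q P j) {i : ℕ}
    {y z : HiggsLattice.Site P 0} (h : thetaOf Q P bad K (i + 1) y ≠ 0)
    (hzy : HiggsLattice.Site.tdist (blockIter i z) (blockIter i y) ≤ 1) :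
    i + 1 ≤ K ∧ blockIter i z ∈ towerRegion bad (towerRad Q P) i 1 := by
  obtain ⟨hiK, t, ht, hd⟩ := exists_near_of_thetaOf_ne_zero h
  refine ⟨hiK, ?_⟩
  have hi' : i ≤ P.K := by omega
  have ht' : blockIter i t ∈ towerRegion bad (towerRad Q P) i 2 := mem_plateau.mp ht
  -- `|y_i − t_i| ≤ dist/Lⁱ + 1 − L^{−i} < M + 1`, so `≤ M` as naturals, and `|t_i − z_i| ≤ M + 1`
  have h1 := tdist_blockIter_le_real hi' y t
  have hL : (0 : ℝ) < (P.L : ℝ) ^ i := pow_pos (by exact_mod_cast P.hL) _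
  have hLinv : 0 < ((P.L : ℝ) ^ i)⁻¹ := inv_pos.mpr hL
  have h2 : (HiggsLattice.Site.tdist y t : ℝ) / (P.L : ℝ) ^ i < (P.M : ℝ) := by
    rw [div_lt_iff₀ hL]; exact hd
  have h3 : (HiggsLattice.Site.tdist (blockIter i y) (blockIter i t) : ℝ) < (P.M : ℝ) + 1 := by linarith
  have h4 : HiggsLattice.Site.tdist (blockIter i y) (blockIter i t) ≤ P.M := by
    have h' : HiggsLattice.Site.tdist (blockIter i y) (blockIter i t) < P.M + 1 := by exact_mod_cast h3
    omega
  have h5 : HiggsLattice.Site.tdist (blockIter i t) (blockIter i z) ≤ P.M + 1 := by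
    have htri := tdist_triangle_real (blockIter i t) (blockIter i y) (blockIter i z)
    rw [tdist_comm (blockIter i t) (blockIter i y), tdist_comm (blockIter i y) (blockIter i z)] at htri
    have h4' : (HiggsLattice.Site.tdist (blockIter i y) (blockIter i t) : ℝ) ≤ (P.M : ℝ) := by exact_mod_cast h4
    have hzy' : (HiggsLattice.Site.tdist (blockIter i z) (blockIter i y) : ℝ) ≤ 1 := by exact_mod_cast hzy
    have : (HiggsLattice.Site.tdist (blockIter i t) (blockIter i z) : ℝ) ≤ (P.M : ℝ) + 1 := by linarith
    exact_mod_cast this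
  have hr0 : 0 ≤ towerRad Q P i := le_trans (by positivity) (hM i)
  rw [towerRegion_eq] at ht' ⊢
  exact mem_regionRel_of_tdist_le hr0 (n := P.M + 1) (by push_cast; exact hM i) ht' h5

/-- Cross-level step: `z_{i+1} ∈ Λ₁^{(i+1)}` ⇒ `z_i ∈ Λ₇^{(i)} ⊂ Λ₂^{(i)}` (p. 566 *"Λ₀^{(j+1)} ⊂ Λ₇^{(j)′}"*). [cite: Balaban1982Higgs2, (2.43) p.566, (3.22) p.588] -/
theorem blockIter_mem_two_of_succ (hR : 0 ≤ Q.R) (hr : 0 ≤ Q.r) {i : ℕ} {z : HiggsLattice.Site P 0}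
    (hz : blockIter (i + 1) z ∈ towerRegion bad (towerRad Q P) (i + 1) 1) : blockIter i z ∈ towerRegion bad (towerRad Q P) i 2 := by
  have h7 : blockIter i z ∈ towerRegion bad (towerRad Q P) i 7 :=
    mem_seven_of_blockOf_mem_succ (towerRad_nonneg hR hr P (i + 1)) (by rw [← blockIter_succ_eq]; exact hz)
  exact towerRegion_antitone (towerRad_nonneg hR hr P i) (by norm_num) h7

variable (hK : K ≤ P.K) (hR : 0 ≤ Q.R) (hr : 0 ≤ Q.r) (hM : ∀ j, (P.M : ℝ) + 1 ≤ towerRad Q P j)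
include hK hR hr hM

/-- **`θ_{j+1}θ_j = θ_{j+1}` (r14's `Nested`, the telescoping hypothesis of (2.51))**: where `θ_{j+1} ≠ 0` (`j ≥ 1`) the point lies over `Λ₁^{(j)} ⊂
Λ₇^{(j−1)′}`, hence in `B^{j−1}(Λ₂^{(j−1)})` where `θ_j = 1`. [cite: Balaban1982Higgs2, (2.51) p.569, p.567] -/
theorem nested_thetaOf : Nested (thetaOf Q P bad K) := by
  intro j z hj1
  by_cases h : thetaOf Q P bad K (j + 1) z = 0
  · rw [h, zero_mul]
  · obtain ⟨hjK, h1⟩ := blockIter_mem_one_of_thetaOf_ne_zero hK hM h (z := z) (by rw [B1Ineq234Concrete.tdist_self]; exact zero_le_one)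
    obtain ⟨i, rfl⟩ : ∃ i, j = i + 1 := ⟨j - 1, by omega⟩
    have h2 : blockIter i z ∈ towerRegion bad (towerRad Q P) i 2 := blockIter_mem_two_of_succ hR hr h1
    rw [thetaOf_eq_one_of_mem (by omega) (mem_plateau.mpr h2), mul_one]

/-- **`θ_k = 1` on `B^{k−1}(Λ₅^{(k−1)})` and on its one-step neighbours** (`1 ≤ k ≤ K`; the tower's `Λ₅^{(k−1)} ⊂ Λ₄^{(k−1)} ⊂ Λ₂^{(k−1)}`, one collar for
the neighbour) — the field `θ_one` of the carriers for the tower `dataTowerN`. [cite: Balaban1982Higgs2, p.567, (2.8) p.558, (3.22) p.588] -/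
theorem thetaOf_one {n : ℕ} (hn : 1 ≤ n) (hRn : (P.L : ℝ) / n * (2 * (P.M : ℝ) + 8) ≤ Q.R) (hr1 : 1 ≤ Q.r) (k : ℕ) (hk1 : 1 ≤ k) (hk : k ≤ K)
    (z : HiggsLattice.Site P 0) (hz : (dataTowerN n hn Q P hRn hr1 bad K).lamAt (k - 1) z) :
    thetaOf Q P bad K k z = 1 ∧ ∀ ν, thetaOf Q P bad K k (z.shift ν) = 1 := by
  obtain ⟨i, rfl⟩ : ∃ i, k = i + 1 := ⟨k - 1, by omega⟩
  change (dataTowerN n hn Q P hRn hr1 bad K).lamAt i z at hz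
  have hlt : i < K := by omega
  have h5 : blockIter i z ∈ towerRegion bad (towerRad Q P) i 5 := by
    have := hz
    unfold Tower.lamAt at this
    rwa [show (dataTowerN n hn Q P hRn hr1 bad K).lam i = towerRegion bad (towerRad Q P) i 5 from
      towerOf_lam_of_lt (bad := bad) (hr := towerRad_nonneg hR hr P) hlt] at this
  have hr0 : 0 ≤ towerRad Q P i := towerRad_nonneg hR hr P i
  refine ⟨thetaOf_eq_one_of_mem hk (mem_plateau.mpr (towerRegion_antitone hr0 (by norm_num) h5)), fun ν => ?_⟩
  -- the neighbour: `|(z+e_ν)_i − z_i| ≤ 1 ≤ r` and `Λ₅ → Λ₄` is one collar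
  have h4 : blockIter i (z.shift ν) ∈ towerRegion bad (towerRad Q P) i 4 := by
    rw [towerRegion_eq] at h5 ⊢
    have h1r : ((1 : ℕ) : ℝ) ≤ towerRad Q P i := by
      have := hM i; have hM0 : (0 : ℝ) ≤ (P.M : ℝ) := Nat.cast_nonneg _; push_cast; linarith
    exact mem_regionRel_of_tdist_le hr0 h1r h5 (tdist_blockIter_shift_le_one (by omega) z ν)
  exact thetaOf_eq_one_of_mem hk (mem_plateau.mpr (towerRegion_antitone hr0 (by norm_num) h4))

/-- **The support of `θ_{k+2}` and its neighbours lie over `B^k(Λ₅^{(k)})`** (`k + 2 ≤ K`): `Λ₁^{(k+1)} ⊂ Λ₇^{(k)′}`, `Λ₇ ⊂ Λ₅` — the field `θ_zero`.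
[cite: Balaban1982Higgs2, p.567, (2.43) p.566, (3.22) p.588] -/
theorem thetaOf_zero {n : ℕ} (hn : 1 ≤ n) (hRn : (P.L : ℝ) / n * (2 * (P.M : ℝ) + 8) ≤ Q.R) (hr1 : 1 ≤ Q.r) (k : ℕ) (hk : k + 2 ≤ K)
    (z : HiggsLattice.Site P 0) (h : thetaOf Q P bad K (k + 2) z ≠ 0 ∨ ∃ ν, thetaOf Q P bad K (k + 2) (z.shift ν) ≠ 0) :
    (dataTowerN n hn Q P hRn hr1 bad K).lamAt k z := by
  have h1 : blockIter (k + 1) z ∈ towerRegion bad (towerRad Q P) (k + 1) 1 := by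
    rcases h with h | ⟨ν, h⟩
    · exact (blockIter_mem_one_of_thetaOf_ne_zero hK hM h (z := z) (by rw [B1Ineq234Concrete.tdist_self]; exact zero_le_one)).2
    · exact (blockIter_mem_one_of_thetaOf_ne_zero hK hM h (z := z) (tdist_blockIter_shift_le_one (k := k + 1) (by omega) z ν)).2
  have h7 : blockIter k z ∈ towerRegion bad (towerRad Q P) k 7 :=
    mem_seven_of_blockOf_mem_succ (towerRad_nonneg hR hr P (k + 1)) (by rw [← blockIter_succ_eq]; exact h1)
  have h5 : blockIter k z ∈ towerRegion bad (towerRad Q P) k 5 := towerRegion_antitone (towerRad_nonneg hR hr P k) (by norm_num) h7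
  unfold Tower.lamAt
  rw [show (dataTowerN n hn Q P hRn hr1 bad K).lam k = towerRegion bad (towerRad Q P) k 5 from
    towerOf_lam_of_lt (bad := bad) (hr := towerRad_nonneg hR hr P) (by omega)]
  exact h5

/-- **THE SLICE INCLUSION**: where `θ_{j+2} ≠ 0` at `z` or at a neighbour, the `(j+2)`-block label of `z` lies in `(Λ₁^{(j+1)})′` (print's slice
surrounds `B^{j+1}(Λ₂^{(j+1)})` from outside; `Λ₁` is a union of blocks) — the field `slice_sub` of `RegionsDataN n` for `n ≤ 2`.
[cite: Balaban1982Higgs2, p.567, (2.8) p.558] -/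
theorem thetaOf_slice {n : ℕ} (hn2 : n ≤ 2) (j : ℕ) (z : HiggsLattice.Site P 0) (ν : Fin P.d)
    (h : thetaOf Q P bad K (j + 2) z ≠ 0 ∨ thetaOf Q P bad K (j + 2) (z.shift ν) ≠ 0) :
    blockIter (j + 2) z ∈ L2OfN n Q P bad (j + 2) := by
  have h1 : blockIter (j + 1) z ∈ towerRegion bad (towerRad Q P) (j + 1) 1 := by
    rcases h with h | h
    · exact (blockIter_mem_one_of_thetaOf_ne_zero hK hM h (z := z) (by rw [B1Ineq234Concrete.tdist_self]; exact zero_le_one)).2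
    · have hjK : j + 1 ≤ P.K := by have := (exists_near_of_thetaOf_ne_zero h).1; omega
      exact (blockIter_mem_one_of_thetaOf_ne_zero hK hM h (z := z) (tdist_blockIter_shift_le_one hjK z ν)).2
  show blockIter (j + 2) z ∈ prime (towerRegion bad (towerRad Q P) (j + 1) (n - 1))
  have hsub : towerRegion bad (towerRad Q P) (j + 1) 1 ⊆ towerRegion bad (towerRad Q P) (j + 1) (n - 1) :=
    towerRegion_antitone (towerRad_nonneg hR hr P (j + 1)) (by omega)
  refine prime_mono hsub ((mem_prime _ _).mpr fun x hx => ?_)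
  rw [blockIter_succ_eq] at hx
  exact (towerRegion_blockOf_congr (j + 1) 1 hx).mpr h1

end Collars

/-! ## §4 The datum of the constructed-regions family with `θ` CONSTRUCTED: only print's free data remain -/

section OfFields

variable {n : ℕ} {Q : B2.Params} {Γ : MinConsts} {M : ℕ} {m2 : ℝ}

/-- From `R ≥ (L/n)(2M + 8)` with `n ≤ 2`: `M + 1 ≤ R ≤ towerRad` at every level. [cite: Balaban1982Higgs2, (2.7) p.558] -/
theorem M_add_one_le_towerRad (hn1 : 1 ≤ n) (hn2 : n ≤ 2) (P : HiggsLattice.Params)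
    (hRn : (P.L : ℝ) / n * (2 * (P.M : ℝ) + 8) ≤ Q.R) (hr : 0 ≤ Q.r) (j : ℕ) : (P.M : ℝ) + 1 ≤ towerRad Q P j := by
  have hL : (1 : ℝ) ≤ (P.L : ℝ) := by exact_mod_cast P.hL
  have hMr : (0 : ℝ) ≤ (P.M : ℝ) := Nat.cast_nonneg _
  have hn : (n : ℝ) ≤ 2 := by exact_mod_cast hn2
  have hn0 : (0 : ℝ) < (n : ℝ) := by exact_mod_cast (lt_of_lt_of_le Nat.zero_lt_one hn1)
  have h1 : (P.M : ℝ) + 1 ≤ (P.L : ℝ) / n * (2 * (P.M : ℝ) + 8) := by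
    rw [div_mul_eq_mul_div, le_div_iff₀ hn0]
    nlinarith
  exact (h1.trans hRn).trans (le_towerRad (R_pos_ofN hn1 hRn).le hr P j)

/-- **THE DATUM WITH `θ_k` CONSTRUCTED** (`1 ≤ n ≤ 2`): torus of the sub-family with large-block factor `M`, steps `K ≤` the lattice's with `Lᴷε ≤ ε₀ ≤ 1`,
`R ≥ (L/n)(2M + 8)`, `r ≥ 1`, `c_θ·M ≥ 1` (the O(1) of *"|∂θ| ≤ O(1)"*), the large-field points of every step, charge data, `A₀`, `A_k`, `Φ` — and
`θ := thetaOf`, with `Nested`, range, `θ_one`, `θ_zero`, `θ_above`, `θ_lip` and `slice_sub` ALL PROVED (§2–§3). [cite: Balaban1982Higgs2, Prop. 3.1 p.589, p.567, (3.2) p.583, (2.43) p.566] -/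
def _root_.Literature.MathematicalPhysics.QuantumFieldTheory.Balaban1983to89.B2Prop31MinimizerRegionsN.RegionsDataN.ofFields
    (hn1 : 1 ≤ n) (hn2 : n ≤ 2) (P : HiggsLattice.Params) (hPL : P.L = Q.L) (hPd : P.d = Q.d) (hPM : P.M = M) (S : Shape P) (N K : ℕ)
    (hK : K ≤ P.K) (hε₀ : P.mesh K ≤ Γ.ε₀) (hmesh1 : P.mesh K ≤ 1) (hRn : (P.L : ℝ) / n * (2 * (P.M : ℝ) + 8) ≤ Q.R) (hr : 1 ≤ Q.r)
    (hcθ : 1 ≤ Γ.cθ * (P.M : ℝ)) (bad : (j : ℕ) → Set (HiggsLattice.Site P j)) (C : ChargeData N) (hCe : C.e = Γ.e)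
    (A₀ : HiggsLattice.VecField P 0) (Ac : (k : ℕ) → HiggsLattice.VecField P k)
    (Φ : Cfg (dataTowerN n hn1 Q P hRn hr bad K).regions N) : RegionsDataN n Q Γ M m2 where
  hn1 := hn1
  hn3 := hn2.trans (by norm_num)
  P := P
  hL := hPL
  hd := hPd
  hM := hPM
  S := S
  N := N
  K := K
  hK := hK
  hε₀ := hε₀
  hmesh1 := hmesh1
  hR := hRn
  hr := hr
  bad := bad
  C := C
  hCe := hCe
  θ := thetaOf Q P bad K
  θ_nested := nested_thetaOf hK (R_pos_ofN hn1 hRn).le (zero_le_one.trans hr) (M_add_one_le_towerRad hn1 hn2 P hRn (zero_le_one.trans hr))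
  θ_range := thetaOf_range
  θ_one := thetaOf_one hK (R_pos_ofN hn1 hRn).le (zero_le_one.trans hr) (M_add_one_le_towerRad hn1 hn2 P hRn (zero_le_one.trans hr)) hn1 hRn hr
  θ_zero := thetaOf_zero hK (R_pos_ofN hn1 hRn).le (zero_le_one.trans hr) (M_add_one_le_towerRad hn1 hn2 P hRn (zero_le_one.trans hr)) hn1 hRn hr
  θ_above m hm z := thetaOf_above hm z
  θ_lip k z ν := by
    refine (thetaOf_lip k z ν).trans ?_
    have hMpos : (0 : ℝ) < (P.M : ℝ) := by exact_mod_cast P.hM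
    have hLk : 0 ≤ ((P.L : ℝ) ^ k)⁻¹ := inv_nonneg.mpr (pow_nonneg (Nat.cast_nonneg _) _)
    have h1 : (P.M : ℝ)⁻¹ ≤ Γ.cθ := by rw [inv_le_iff_one_le_mul₀ hMpos]; linarith
    exact mul_le_mul_of_nonneg_right h1 hLk
  A₀ := A₀
  Ac := Ac
  Φ := Φ
  slice_sub := thetaOf_slice hK (R_pos_ofN hn1 hRn).le (zero_le_one.trans hr) (M_add_one_le_towerRad hn1 hn2 P hRn (zero_le_one.trans hr)) hn2

/-- The cut-offs of the datum are `thetaOf` (definitional). [cite: Balaban1982Higgs2, p.567] -/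
theorem ofFields_θ (hn1 : 1 ≤ n) (hn2 : n ≤ 2) (P : HiggsLattice.Params) (hPL : P.L = Q.L) (hPd : P.d = Q.d) (hPM : P.M = M) (S : Shape P)
    (N K : ℕ) (hK : K ≤ P.K) (hε₀ : P.mesh K ≤ Γ.ε₀) (hmesh1 : P.mesh K ≤ 1) (hRn : (P.L : ℝ) / n * (2 * (P.M : ℝ) + 8) ≤ Q.R) (hr : 1 ≤ Q.r)
    (hcθ : 1 ≤ Γ.cθ * (P.M : ℝ)) (bad : (j : ℕ) → Set (HiggsLattice.Site P j)) (C : ChargeData N) (hCe : C.e = Γ.e)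
    (A₀ : HiggsLattice.VecField P 0) (Ac : (k : ℕ) → HiggsLattice.VecField P k) (Φ : Cfg (dataTowerN n hn1 Q P hRn hr bad K).regions N) :
    (RegionsDataN.ofFields (Γ := Γ) (m2 := m2) hn1 hn2 P hPL hPd hPM S N K hK hε₀ hmesh1 hRn hr hcθ bad C hCe A₀ Ac Φ).θ = thetaOf Q P bad K := rfl

end OfFields

end Literature.MathematicalPhysics.QuantumFieldTheory.Balaban1983to89.B2Eq245Theta

end
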